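import Mathlib
import HarnessLib.Audit.Tags

/-!
# Venture HSemireg — the FIRST-ORDER MODEL of the PAD-4 anchor, and THEOREM L^ζ of the cell (STATED, NOT PROVED)

HONEST FRAMING. Lean index of the computation cell `pub-hsemireg` (S4-PUSH, H2 door PAD-4; director-hodge g7 ORDER
«TIER 1 FILE A», cell INBOX l.29819, 2026-08-27; typer `hodge-lit-semireg-typer` g6). This file DEFINES a finite-data
model and STATES one sentence of the cell's own pencil mathematics as a kernel-OPEN obligation (`@[conjecture]` = not
proved in Lean; in the cell it is THEOREM L^ζ, pencil, two independent referee reads PASS). Nothing is proved here except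
bookkeeping (`rel_dead_symm`, `upperRowPure_self`, `diagonalCriterion_of_H2`, `not_H1_and_H2_of_main`). No variety, sheaf,
Atiyah class or semiregularity map is constructed; no Literature fact is declared; no instance, no notation. NOTHING HERE SAYS THAT HC ∕ HC_CM ∕ HC_AV ∕ W₆ ∕
HC_Kum4Type HOLDS OR FAILS, and the model-to-sheaf bridge (Buchweitz–Flenner 2003 Prop. 4.4 ∕ Cor. 4.3, the Kodaira–Spencer
∕ contraction carrier) is NOT included: `H2` below is a statement about finite-dimensional linear systems, related to the
geometric first-order obstructions only by the cell's pencil notes cited in §SOURCES.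

SCOPE SENTENCE OF RECORD: printed verbatim in the docstring of `TheoremLZeta` below (director-hodge g7 l.29811 adopting the
literature seat's l.29800, AMENDED l.29844 after the typer's pre-scope l.29823 §A, shape confirmed l.29865; SIGNED by the author
lineage s4-search-1 g20, verdict 5cfea059015d0a70). The class quantified over is the STANDARD-NULL-LETTER class (phases
`ζ ∈ μ₄`) = census state y as first stamped (HEAD v6 ∕ v6.1); HEAD v6.2 079f4a13f702ef03 widens y to all rank-1 letter
directions `v ∈ ℤ[i]²` (REMARK G, (F0) inside y) — those other directions are NOT modelled in this file.
WHY (E1) AND NOT THE DIAGONAL CRITERION: `H2` is the FULL first-order condition (E1) — for every `κ ∈ T_W ≅ M₄(ℂ)` the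
systems `φ ∘ η = ob_κ(E₋)`, `η ∈ Hom(E₋, E₊[2]) = ⊕ H²(P − N)`, and `η' ∘ φ = ob_κ(E₊)` are solvable (DOORY0-SCOPING §2
LEMMA, THEOREM P «or of E₊»; PAD4-DIAGCLOSURE §6 (E1); PAD4-LEAK FULL(X)); the demand rows alone (`DiagonalCriterion`) are
PASSED by D55 (PAD4-DIAGCLOSURE §2 THEOREM C — with a fully charged constituent, hence `H1`) and by D₄₅ (×2), so with them in
place of `H2` the sentence would be false on the cell's own record; THEOREM L^ζ's proof (PAD4-THEOREM-L §1–§3, §5) reads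
off-diagonal rows ((R1), (R2)) and one change of splitting of `E₊` — its hypothesis is (E1).

THE MODEL (§2; coordinates, `ℂ`-valued). `S⁴ = Π_{f<4} S_f`, `S_f = E_i × E_i`, `E_i = ℂ∕ℤ[i] ≅ (y² = x³ − x)`; the null
letter `ℓ_ζ = (1,ζ)(1,ζ)^*` is the fibre class of `π_ζ : S_f → C_ζ ≅ E_i`, `λ = z_A + ζ z_B` (PAD4-THEOREM-L (6.6)(i)). For ONE
letter `±d ℓ_ζ` per factor the cohomology of `S_f ≅ C_ζ × F_ζ` is Künneth ∕ Leray (PAD4-LEAK §1): `H⁰(dℓ) = R_d :=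
H⁰(C, O(d·o))` (Riemann–Roch basis `x^j y^k`, `2j + 3k ≤ d`, `k ≤ 1`; products by `y² = x³ − x`), `H¹(dℓ) = R_d ⊗ W`,
`H¹(−dℓ) = R_d^*` (Serre duality; the module maps `H⁰(θ^e) × H¹(θ^{−d}) → H¹(θ^{e−d})` are transposed ring products for
`e < d`, the evaluation `η(s) ∈ H¹(O_C) = Ξ_ζ = ℂ·ξ̄_ζ`, `ξ̄_ζ = ē_A + ζ̄ ē_B`, for `e = d`, and `0` for `e > d`),
`H²(−dℓ) = R_d^* ⊗ W`; class `0`: `ℂ, V = ⟨ē_A, ē_B⟩ = H^{0,1}(S_f), Λ²V`; `W = H¹(F_ζ, O) = V ∕ Ξ_ζ ≅ ℂ` by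
`w_ζ(a ē_A + b ē_B) = b − ζ̄ a`, `Ξ_ζ ⊗ W = Λ²V` by `ξ̄_ζ ∧ ē_B = ē_A ∧ ē_B`; `H²(S⁴, ·) = ⊕_{Σ q_f = 2} ⊗_f H^{q_f}`,
`V_g ∧ V_{g'} ≅ V_g ⊗ V_{g'}` (`g < g'`); `T_W ≅ M₄(ℂ)` with `κ(ξ_ζ^{(f)})_τ = ζ k_{fτ} ē_{A_τ} + k_{τf} ē_{B_τ}` ((6.6)(iii));
demand `ob_κ(X) = (κ ∪ c₁X)^{0,2} = Σ_f c_f ξ̄_{ζ_f}^{(f)} ∧ κ(ξ_{ζ_f}^{(f)})` (PAD4-DIAGCLOSURE §0). Normalisations (duality,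
`W ≅ ℂ`, `Λ²V ≅ ℂ`, the constant of `ob`) are fixed once per space and do not affect solvability.

FAITHFULNESS (what is modelled, what is cut, in which direction). (a) SECTIONS `φ_{NP}` have coordinates in the model
exactly when `N − P` is same-layer and EFFECTIVE in the sense of PAD4-THEOREM-L §5 (P0) (on every factor `P` uncharged, or
on `N`'s ray with charge `≤`; (P0) = the cell's ×2 reading of Mumford §16 + Künneth: sections need a psd class and a cross-phase one-factor
difference is indefinite, so other same-layer pairs have `H⁰ = 0`).
Geometric entries from a higher-layer `N` to a lower-layer `P` exist but only ever multiply unknowns that vanish or sit in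
rows the model drops (next item), so they need no coordinates. (b) UNKNOWNS `η_{P'} ∈ H²(P' − X)` and ROWS `R` are kept
exactly when `P' − X`, resp. `R − X`, is same-layer and PHASE-PURE (one letter `±d ℓ_ζ` or `0` per factor); otherwise
`dead`; an UPPER row is kept only if all its participants are modelled (`UpperRowPure`). JUSTIFICATION, both directions:
(i) geometric (H2) ⇒ (E1) [DOORY0 §2] ⇒ model `H2`: in a kept LOWER row no cross-phase unknown occurs (if `P' − X` is
cross-phase on a factor and `φ_{RP'} ≠ 0` then `R − X` is cross-phase there — PAD4-THEOREM-L (6.1) REMARK N; its `E₊`-side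
analogue fails off the diagonal, whence the guard) and no cross-layer unknown contributes (a lower-layer `P'` has
`H²(P' − X) = 0` — every factor of `(t' − t)h + letters`, `t' < t`, has a negative eigenvalue, so no Künneth component of
total degree 2; a higher-layer `P'` receives entries only from rows above layer `t_X`, which are not kept — PAD4-E7-TWIN §1
LEMMA L7 (LL′), ×2), so every kept row carries all its geometric participants and a geometric solution restricts to a model
solution;
(ii) the ×2 pencil proof of THEOREM L^ζ reads only kept rows and unknowns ((D_X), (R1), (R2); REMARK N is the referees'
«sentence that makes the transfer work») and one unipotent change of splitting of `E₊` with entries constants and model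
sections, under which (E1) is invariant (naturality `(ob_{P″} − ob_P)·g = 0`, `g ∈ H⁰(P″ − P)`, holds in the model: the
`V_f`-factor `ξ̄_ζ` of each term of `κ ∪ c₁(P″ − P)` is killed by `w_ζ`), so it proves `TheoremLZetaMain` ∕ `TheoremLZeta`
AS STATED (kernel status: OPEN). (c) `Minimal` (PAD4-FIRSTORDER §0 «minimal presentation, no isomorphism entries») is a
hypothesis: without it the sentence is false (pad `E₊`, `E₋` with a cancelling pair of one multi-factor class). (d) `H1` is
the μ-word only (director's spec; THEOREM L^ζ uses (H1) only through «μ ≠ 0 ⇒ a fully charged constituent»,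
`exists_fullyCharged_of_H1` below); the class condition `ch(E) ∈ ℚ[h] ⊕ W` and (Ψ) (PAD4-THEOREM-L (6.5)) are NOT imposed
— weaker hypothesis, same conclusion. (e) OUTSIDE the model, as outside THEOREM L^ζ ((6.8)): several letters per factor,
`α ≠ α'` blocks, other rank-1 directions (F0), `Pic⁰`-twists, `≥ 3` levels, non-split bundles, smaller tangent models than `T_W`.

SOURCES (cell documents, sha16): PAD4-THEOREM-L-search-1.md v1.2 66fb170a6cb906b7 (§0, §5 L^ζ, (6.1) REMARK N, (6.2),
(6.5), (6.6), (6.8); referee ×2: s4-ref-2 g3 a0ec94ca101589e9, s4-ref g66 7768f9be2797e6b7); PAD4-FIRSTORDER-search-1.md v1.1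
93f71c42cb445756 (§0 (H1)(H2) T_W, §1); PAD4-DIAGCLOSURE-search-1.md v1.2 7d6949f2a7067e18 (§0, §2 THEOREM C = D55, §6 (E1));
PAD4-LEAK-search-1.md v1.0 30757ae6d074958d (§1); DOORY0-SCOPING-search-1.md 6646c0578f77052d (§2 LEMMA: `ob_κ(E₋)` diagonal,
`∈ im(φ∘)` iff `= φ∘η`); census state y (HEAD v6.1 a947beb21966a48c; HEAD v6.2 079f4a13f702ef03, y ⊇ (F0)); DEADLINE-PAD4-
ONE-LAYER.md v1.7 1bc711ef24b977f6; pre-scope TIER1-MODEL-FILE-PRESCOPE-typer-g6.md f0e98e988b64850b; faithfulness read + scope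
signature s4-search-1 g20 5cfea059015d0a70 (P1 = `UpperRowPure`). COMPANION FILE B (gs-eng-2 g48, standalone; same constituent
field names): `Pad4PhaseKernelCertificate.lean` (144 `T_W` phase cases, effectivity rule (P0), layer eigenvalue sign),
`Pad4D45Certificate.lean` (D₄₅ data) — cited in prose only.
-/

noncomputable section
namespace Summit.Ventures.HSemireg.Pad4FirstOrder
open Finset

/-! ## §0 Designs (finite data) -/
/-- A constituent `t·h + Σ_f c_f ℓ_{ζ_f}` of a two-level ⊕-block line-bundle design on the PAD-4 anchor
`S⁴ = Π_{f<4} (E_i × E_i)`: a layer `t ∈ ℤ`, and on each factor `f : Fin 4` ONE null letter `c_f ℓ_{ζ_f}` with integer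
charge `c_f ≥ 0` and phase `ζ_f = i^{k_f}`, `k_f : Fin 4` (the phase is immaterial where `c_f = 0`). [definition of this file] -/
structure Constituent where
  /-- the `h`-layer `t` (`h` = the product principal polarisation). -/
  layer : ℤ
  /-- the charge `c_f ≥ 0` of the letter on factor `f`. -/
  charge : Fin 4 → ℕ
  /-- the phase exponent `k_f` of the letter on factor `f` (`ζ_f = i^{k_f} ∈ μ₄`). -/
  phase : Fin 4 → Fin 4

/-- A two-level design `0 → E₊ = ⊕_j P_j →φ E₋ = ⊕_i N_i → E → 0`: the lists of lower (`N`, summands of `E₋`) and upper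
(`P`, summands of `E₊`) constituents; a constituent of multiplicity `m` is listed `m` times. [definition of this file] -/
structure Design where
  /-- the summands `N_i` of `E₋` (target of `φ`). -/
  lower : List Constituent
  /-- the summands `P_j` of `E₊` (source of `φ`). -/
  upper : List Constituent

namespace Constituent

/-- number of factors on which the constituent is charged (`c_f ≠ 0`). -/
def nCharged (X : Constituent) : ℕ := (univ.filter fun g : Fin 4 => X.charge g ≠ 0).card
/-- `ζ = i^k` as a Gaussian integer. -/
def zetaG (k : Fin 4) : GaussianInt := (⟨0, 1⟩ : GaussianInt) ^ (k : ℕ)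
/-- the off-diagonal letter coefficient `β_f = c_f · ζ̄_f` of `c_f ℓ_{ζ_f}` (`ℓ_ζ = (1,ζ)(1,ζ)^*`; PAD4-THEOREM-L (6.5)/(6.6)). -/
def beta (X : Constituent) (g : Fin 4) : GaussianInt := (X.charge g : GaussianInt) * star (zetaG (X.phase g))
/-- the constituent's contribution `Π_f β_f` to the `W`-part `μ` of `ch` (PAD4-FIRSTORDER §0 (H1)). -/
def muTerm (X : Constituent) : GaussianInt := ∏ g : Fin 4, X.beta g

end Constituent

namespace Design
/-- number of `N`-summands. -/
def nN (D : Design) : ℕ := D.lower.length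
/-- number of `P`-summands. -/
def nP (D : Design) : ℕ := D.upper.length
/-- the `i`-th `N`-summand. -/
def N (D : Design) (i : Fin D.nN) : Constituent := D.lower.get i
/-- the `j`-th `P`-summand. -/
def P (D : Design) (j : Fin D.nP) : Constituent := D.upper.get j
/-- **the μ-word**: `μ(D) = Σ_{N} Π_f β_f(N) − Σ_{P} Π_f β_f(P) ∈ ℤ[i]`, the `W = ⟨⊗_f E_{AB}, ⊗_f E_{BA}⟩`-part of
`ch(E) = Σ_X ε_X ch O(X)` up to a fixed non-zero constant (PAD4-FIRSTORDER §0 (H1); PAD4-THEOREM-L (6.5)). -/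
def mu (D : Design) : GaussianInt := (D.lower.map Constituent.muTerm).sum - (D.upper.map Constituent.muTerm).sum

/-- **(H1) as the μ-word predicate**: the `W`-part of `ch(E)` is non-zero. (The full class condition
`ch(E) ∈ ℚ[h] ⊕ W` of PAD4-FIRSTORDER §0 is NOT imposed: THEOREM L^ζ uses (H1) only through `μ ≠ 0`.) Decidable. -/
def H1 (D : Design) : Prop := D.mu ≠ 0

/-- **class y**: the type `Design` IS the standard-null-letter two-level class of census HEAD v6/v6.1 (one null letter
`c_f ℓ_{ζ_f}` per factor per constituent, integer `c_f ≥ 0`, `ζ_f ∈ μ₄`; any support, phases, multiplicities, layers);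
the one datum the type does not carry is the rank condition `rk E = #N − #P = 4` (PAD4-FIRSTORDER §0: `E₋` has `m + 4`
summands, `E₊` has `m`); a hypothesis of the stated sentence, not used by the pencil proof. -/
def InClassY (D : Design) : Prop := D.nN = D.nP + 4

end Design
/-! ## §1 The per-factor relative class of an ordered pair of constituents -/
/-- The class of `Y − X` on ONE factor, as seen by the model: `zero`; a positive letter `+e ℓ_ζ` (`e ≥ 1`); a negative
letter `−d ℓ_ζ` (`d ≥ 1`); or `dead` = the pair is in different layers, or both are charged on this factor with different
phases (cross-phase). Dead factors carry no sections, no unknowns and no rows in the model (module docstring §FAITHFULNESS). -/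
inductive Rel where
  | zero : Rel
  | pos : ℕ → Fin 4 → Rel
  | neg : ℕ → Fin 4 → Rel
  | dead : Rel

/-- `rel Y X g` = the model class of `(Y − X)` on factor `g` (PAD4-THEOREM-L §5 (P0): comparable letters lie on one ray). -/
def rel (Y X : Constituent) (g : Fin 4) : Rel :=
  if Y.layer ≠ X.layer then Rel.dead
  else if Y.charge g = 0 ∧ X.charge g = 0 then Rel.zero
  else if X.charge g = 0 then Rel.pos (Y.charge g) (Y.phase g)
  else if Y.charge g = 0 then Rel.neg (X.charge g) (X.phase g)
  else if Y.phase g ≠ X.phase g then Rel.dead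
  else if X.charge g < Y.charge g then Rel.pos (Y.charge g - X.charge g) (Y.phase g)
  else if Y.charge g < X.charge g then Rel.neg (X.charge g - Y.charge g) (X.phase g)
  else Rel.zero

/-- `dead` is symmetric: a pair is cross-layer ∕ cross-phase on a factor in both orders or in neither. -/
theorem rel_dead_symm (X Y : Constituent) (g : Fin 4) (h : rel X Y g = Rel.dead) : rel Y X g = Rel.dead := by
  unfold rel at h ⊢
  split_ifs at h with h1 h2 h3 h4 h5
  · exact if_pos fun e => h1 e.symm
  · rw [if_neg fun hh => h1 fun e => hh e.symm, if_neg fun hh => h2 ⟨hh.2, hh.1⟩, if_neg h4, if_neg h3]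
    exact if_pos fun e => h5 e.symm

/-! ## §2 The cohomology model (Künneth–Leray pieces in coordinates; see the module docstring §THE MODEL)

Index conventions: `V = ⟨ē_A, ē_B⟩` has indices `(0,0) ↦ ē_A`, `(1,0) ↦ ē_B`; `ℂ`-lines (`H⁰(O)`, `Λ²V`, `W`) have the
index `(0,0)`; `R_d`, `R_d^*`, `R_d ⊗ W`, `R_d^* ⊗ W` have the monomial indices `(j,k)` of `x^j y^k`, `2j + 3k ≤ d`, `k ≤ 1`. -/

/-- Riemann–Roch monomial indices `(j,k)` of `R_d = H⁰(C, O(d·o))`: `x^j y^k`, `2j + 3k ≤ d`, `k ≤ 1` (`dim R_d = d`, `R_0 = ℂ`). -/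
def monIdx (d : ℕ) : Finset (ℕ × ℕ) := ((range (d + 1)) ×ˢ (range 2)).filter fun m => 2 * m.1 + 3 * m.2 ≤ d

/-- structure constants of `R = ℂ[x, y]∕(y² − x³ + x)` in the monomial basis: the coefficient of `x^{o.1} y^{o.2}` in
`(x^{a.1} y^{a.2}) · (x^{b.1} y^{b.2})`, using `y² = x³ − x`. -/
def mulCoef (a b o : ℕ × ℕ) : ℤ :=
  if a.2 + b.2 ≤ 1 then (if o = (a.1 + b.1, a.2 + b.2) then 1 else 0)
  else (if o = (a.1 + b.1 + 3, 0) then 1 else 0) - (if o = (a.1 + b.1 + 1, 0) then 1 else 0)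

/-- basis indices of the model piece `H^q` of a per-factor class (empty = the piece is `0`; see §2 header). -/
def idx : Rel → ℕ → Finset (ℕ × ℕ)
  | Rel.zero, 0 => {(0, 0)}
  | Rel.zero, 1 => {(0, 0), (1, 0)}
  | Rel.zero, 2 => {(0, 0)}
  | Rel.pos e _, 0 => monIdx e
  | Rel.pos e _, 1 => monIdx e
  | Rel.neg d _, 1 => monIdx d
  | Rel.neg d _, 2 => monIdx d
  | _, _ => ∅

/-- `ζ = i^k ∈ ℂ`. -/
def zetaC (k : Fin 4) : ℂ := Complex.I ^ (k : ℕ)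
/-- `ζ̄ = ζ⁻¹`. -/
def zetaBar (k : Fin 4) : ℂ := (zetaC k)⁻¹
/-- coordinates of `ξ̄_ζ = ē_A + ζ̄ ē_B ∈ V` (`(0,0) ↦ ē_A`, `(1,0) ↦ ē_B`). -/
def xiBar (k : Fin 4) (o : ℕ × ℕ) : ℂ := if o = (0, 0) then 1 else if o = (1, 0) then zetaBar k else 0

/-- the functional `w_ζ : V → W ≅ ℂ`, `w_ζ(ē_A) = −ζ̄`, `w_ζ(ē_B) = 1` (kernel `Ξ_ζ`). -/
def wCoef (k : Fin 4) (ι : ℕ × ℕ) : ℂ := if ι = (0, 0) then -zetaBar k else if ι = (1, 0) then 1 else 0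

/-- **per-factor product** `H^q(unknown class rU) × H⁰(section class rS) → H^q(sum)`: the coefficient of the target index `o`
in `(basis vector ι) · (basis monomial a)`; `rS` is `zero` (constant `1`) or `pos e ζ`. The PAD4-LEAK §1 dictionary: `ℂ·R_e = R_e`;
`V·R_e → R_e ⊗ W` by `w_ζ`; `Λ²V·R_e = 0`; `R_c·R_e ⊂ R_{c+e}` (ring product); `R_d^*·R_e → R_{d−e}^*` (transpose) for `e < d`,
`→ Ξ_ζ ⊂ V` resp. `Ξ_ζ ⊗ W = Λ²V` (evaluation) for `e = d`, `→ 0` for `e > d`. -/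
def coef (rU : Rel) (q : ℕ) (ι : ℕ × ℕ) (rS : Rel) (a : ℕ × ℕ) (o : ℕ × ℕ) : ℂ :=
  match rS with
  | Rel.zero => if o = ι then 1 else 0
  | Rel.pos e kS =>
    match rU with
    | Rel.zero =>
      if q = 0 then (if o = a then 1 else 0)
      else if q = 1 then wCoef kS ι * (if o = a then 1 else 0)
      else 0
    | Rel.pos _ kU => if kU = kS then (mulCoef ι a o : ℂ) else 0
    | Rel.neg d kU =>
      if kU ≠ kS then 0
      else if e < d then (mulCoef a o ι : ℂ)
      else if e = d then
        (if q = 1 then (if a = ι then xiBar kU o else 0)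
         else (if a = ι ∧ o = (0, 0) then 1 else 0))
      else 0
    | Rel.dead => 0
  | _ => 0

/-- the degree distributions `(q_g)_{g<4}` with `Σ q_g = 2` (Künneth components of `H²(S⁴, ·)`). -/
def qDist2 : Finset (Fin 4 → ℕ) := (Fintype.piFinset fun _ : Fin 4 => range 3).filter fun q => ∑ g, q g = 2

/-- basis indices `(q, o)` of the model space `H²(S⁴, Y − X)` (empty as soon as one factor is `dead` or three are negative, [W4]). -/
def idxH2 (Y X : Constituent) : Finset ((Fin 4 → ℕ) × (Fin 4 → ℕ × ℕ)) :=
  qDist2.biUnion fun q => (Fintype.piFinset fun g => idx (rel Y X g) (q g)).image fun o => (q, o)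

/-- basis indices of the model space `H⁰(S⁴, Y − X)` of SECTIONS (entries `X → Y`): non-empty iff same layer and on every
factor `X` is uncharged or on `Y`'s ray with charge `≤` ((P0)). -/
def idxH0 (Y X : Constituent) : Finset (Fin 4 → ℕ × ℕ) := Fintype.piFinset fun g => idx (rel Y X g) 0

/-- the product on `S⁴ = Π_g S_g`: unknown (classes `rU`, index `(q, ι)`) times section (classes `rS`, index `a`) read at the
index `(q, o)` of `H²(rU + rS)` (`q` preserved factorwise; no Koszul sign). -/
def coefProd (rU rS : Fin 4 → Rel) (q : Fin 4 → ℕ) (ι a o : Fin 4 → ℕ × ℕ) : ℂ :=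
  ∏ g : Fin 4, coef (rU g) (q g) (ι g) (rS g) (a g) (o g)

/-- `κ(ξ_ζ^{(f)})_τ = ζ k_{fτ} ē_{A_τ} + k_{τf} ē_{B_τ} ∈ V_τ` for `κ ↔ k ∈ M₄(ℂ)` (`e_{A_g} ↦ Σ_j k_{jg} ē_{B_j}`,
`e_{B_j} ↦ Σ_g k_{jg} ē_{A_g}`; PAD4-FIRSTORDER §1, (6.6)(iii): `T_W` is the FULL 16-dimensional space). -/
def kap (κ : Matrix (Fin 4) (Fin 4) ℂ) (k : Fin 4) (f τ : Fin 4) (o : ℕ × ℕ) : ℂ :=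
  if o = (0, 0) then zetaC k * κ f τ else if o = (1, 0) then κ τ f else 0

/-- the degree distribution `1` on `{g, g'}`, `0` elsewhere. -/
def qPair (g g' : Fin 4) : Fin 4 → ℕ := fun f => if f = g ∨ f = g' then 1 else 0
/-- **the demand** `ob_κ(X) = (κ ∪ c₁ X)^{0,2} = Σ_f c_f · ξ̄_{ζ_f}^{(f)} ∧ κ(ξ_{ζ_f}^{(f)}) ∈ Λ²(⊕_g V_g)` (`V_g ∧ V_{g'} ≅ V_g ⊗ V_{g'}`,
`g < g'`, `u ∧ v ↦ u ⊗ v`; PAD4-DIAGCLOSURE §0); the `Λ²V_f`-components vanish for null letters (computed, not assumed). -/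
def ob (X : Constituent) (κ : Matrix (Fin 4) (Fin 4) ℂ) (q : Fin 4 → ℕ) (o : Fin 4 → ℕ × ℕ) : ℂ :=
  ∑ f : Fin 4, ∑ τ : Fin 4, (X.charge f : ℂ) *
    (if τ = f then
      (if q = Pi.single f 2 then
        xiBar (X.phase f) (0, 0) * kap κ (X.phase f) f f (1, 0) - xiBar (X.phase f) (1, 0) * kap κ (X.phase f) f f (0, 0)
       else 0)
     else if q = qPair f τ then
      (if f < τ then xiBar (X.phase f) (o f) * kap κ (X.phase f) f τ (o τ)
       else -(kap κ (X.phase f) f τ (o τ) * xiBar (X.phase f) (o f)))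
     else 0)

/-! ## §3 The first-order systems (E1) and the hypotheses -/
namespace Design

/-- the SECTIONS of a design: `φ i j a` = the coordinate at the Künneth monomial `a` of the entry `φ_{N_i P_j} ∈ H⁰(N_i − P_j)`
of `φ : E₊ → E₋`; only coordinates in `idxH0 (N i) (P j)` are read, so «arbitrary sections» = all functions. -/
abbrev Sections (D : Design) := Fin D.nN → Fin D.nP → (Fin 4 → ℕ × ℕ) → ℂ

/-- **MINIMAL PRESENTATION** (PAD4-FIRSTORDER §0): no isomorphism entries — `φ_{NP} = 0` whenever `N` and `P` have the
same class (same layer, same letters). Without it THEOREM L^ζ is false (pad `E₊`, `E₋` by a cancelling pair). -/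
def Minimal (D : Design) (φ : D.Sections) : Prop :=
  ∀ i j, (∀ g, rel (D.N i) (D.P j) g = Rel.zero) → ∀ a, φ i j a = 0

/-- the `(r, t)`-coordinate of `φ ∘ η` in column `X = N_i`: `Σ_j φ_{N_r P_j} · η_j` in `H²(N_r − N_i)`, `η_j ∈ H²(P_j − N_i)`. -/
def lowerLHS (D : Design) (φ : D.Sections) (η : Fin D.nP → (Fin 4 → ℕ) → (Fin 4 → ℕ × ℕ) → ℂ) (i r : Fin D.nN)
    (t : (Fin 4 → ℕ) × (Fin 4 → ℕ × ℕ)) : ℂ :=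
  ∑ j : Fin D.nP, ∑ u ∈ idxH2 (D.P j) (D.N i), ∑ a ∈ idxH0 (D.N r) (D.P j),
    (if u.1 = t.1 then coefProd (rel (D.P j) (D.N i)) (rel (D.N r) (D.P j)) t.1 u.2 a t.2 else 0) * φ r j a * η j u.1 u.2

/-- the `(s, t)`-coordinate of `η' ∘ φ` for the row object `P_j`: `Σ_i η'_i · φ_{N_i P_s}` in `H²(P_j − P_s)`, `η'_i ∈ H²(P_j − N_i)`. -/
def upperLHS (D : Design) (φ : D.Sections) (η : Fin D.nN → (Fin 4 → ℕ) → (Fin 4 → ℕ × ℕ) → ℂ) (j s : Fin D.nP)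
    (t : (Fin 4 → ℕ) × (Fin 4 → ℕ × ℕ)) : ℂ :=
  ∑ i : Fin D.nN, ∑ u ∈ idxH2 (D.P j) (D.N i), ∑ a ∈ idxH0 (D.N i) (D.P s),
    (if u.1 = t.1 then coefProd (rel (D.P j) (D.N i)) (rel (D.N i) (D.P s)) t.1 u.2 a t.2 else 0) * φ i s a * η i u.1 u.2

/-- **(E1), lower side, column `X = N_i`**: the system `Σ_j φ_{N_r P_j} ∘ η_j = δ_{r i} · ob_κ(N_i)` in `H²(N_r − N_i)`
for all `r`, in the unknowns `η_j ∈ H²(P_j − N_i)` — the `N_i`-column of `φ ∘ η = ob_κ(E₋)`, `η ∈ Hom(E₋, E₊[2])`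
(DOORY0 §2 LEMMA ∕ PAD4-DIAGCLOSURE (E1) ∕ PAD4-LEAK FULL(X): the demand row `r = i` AND all off-diagonal rows). -/
def LowerColumnSolvable (D : Design) (φ : D.Sections) (κ : Matrix (Fin 4) (Fin 4) ℂ) (i : Fin D.nN) : Prop :=
  ∃ η : Fin D.nP → (Fin 4 → ℕ) → (Fin 4 → ℕ × ℕ) → ℂ,
    ∀ r : Fin D.nN, ∀ t ∈ idxH2 (D.N r) (D.N i), D.lowerLHS φ η i r t = if r = i then ob (D.N i) κ t.1 t.2 else 0

/-- **guard for the upper rows** (faithfulness read 5cfea059015d0a70, P1): the row of the pair `(P_j, P_s)` is imposed only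
when every participant `N_i ≥ P_s` (an entry `P_s → N_i` exists) has a phase-pure same-layer unknown class `P_j − N_i`, i.e.
all geometric participants of the row are modelled. Off the diagonal this can fail — a cross-phase `N_i` above an uncharged
factor of `P_s` enters the geometric row through a non-zero (indeed surjective) mixed product (PAD4-THEOREM-L (6.2)): the
`E₊`-side analogue of REMARK N is false; the diagonal row `s = j` always passes (`upperRowPure_self`). Lower rows need no
guard (REMARK N (6.1): `R − X` pure and `P' ≤ R` force `P' − X` pure). -/
def UpperRowPure (D : Design) (j s : Fin D.nP) : Prop :=
  ∀ i, (idxH0 (D.N i) (D.P s)).Nonempty → ∀ g, rel (D.P j) (D.N i) g ≠ Rel.dead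

/-- the diagonal upper row is always kept: `N_i − P_j` effective ⇒ `P_j − N_i` is `zero` or negative on every factor. -/
theorem upperRowPure_self (D : Design) (j : Fin D.nP) : D.UpperRowPure j j := by
  intro i hne g hdead
  have hg : (idx (rel (D.N i) (D.P j) g) 0).Nonempty := (Fintype.piFinset_nonempty.mp hne) g
  rw [rel_dead_symm _ _ g hdead] at hg
  simp [idx] at hg

/-- **(E1), upper side, row object `P_j`**: the system `Σ_i η'_i ∘ φ_{N_i P_s} = δ_{s j} · ob_κ(P_j)` in `H²(P_j − P_s)`
for all `s` whose row is fully modelled (`UpperRowPure`), in the unknowns `η'_i ∈ H²(P_j − N_i)` — the `P_j`-component of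
`η' ∘ φ = ob_κ(E₊)`, `η' ∈ Hom(E₋, E₊[2])` (THEOREM P «or of E₊», PAD4-FIRSTORDER §0; PAD4-LEAK §1 «FULL of the dual design»). -/
def UpperRowSolvable (D : Design) (φ : D.Sections) (κ : Matrix (Fin 4) (Fin 4) ℂ) (j : Fin D.nP) : Prop :=
  ∃ η : Fin D.nN → (Fin 4 → ℕ) → (Fin 4 → ℕ × ℕ) → ℂ,
    ∀ s : Fin D.nP, D.UpperRowPure j s →
      ∀ t ∈ idxH2 (D.P j) (D.P s), D.upperLHS φ η j s t = if s = j then ob (D.P j) κ t.1 t.2 else 0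

/-- **(H2) in the form (E1)**: for EVERY `κ ∈ T_W ≅ M₄(ℂ)` the full first-order systems `φ ∘ η = ob_κ(E₋)` and
`η' ∘ φ = ob_κ(E₊)` are solvable (necessary for `ob_κ(E) = 0`: DOORY0 §2 LEMMA, THEOREM P both sides) — NOT the diagonal criterion. -/
def H2 (D : Design) (φ : D.Sections) : Prop :=
  ∀ κ : Matrix (Fin 4) (Fin 4) ℂ, (∀ i, D.LowerColumnSolvable φ κ i) ∧ (∀ j, D.UpperRowSolvable φ κ j)

/-- the DIAGONAL CRITERION of THEOREM P at every constituent of both levels (the demand rows alone: `ob_κ(X) ∈ Σ Plane`;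
PAD4-FIRSTORDER §0) — NECESSARY only: D55 (PAD4-DIAGCLOSURE §2 THEOREM C) and D₄₅ satisfy it. -/
def DiagonalCriterion (D : Design) (φ : D.Sections) : Prop :=
  ∀ κ : Matrix (Fin 4) (Fin 4) ℂ,
    (∀ i, ∃ η, ∀ t ∈ idxH2 (D.N i) (D.N i), D.lowerLHS φ η i i t = ob (D.N i) κ t.1 t.2) ∧
    (∀ j, ∃ η, ∀ t ∈ idxH2 (D.P j) (D.P j), D.upperLHS φ η j j t = ob (D.P j) κ t.1 t.2)

/-- (E1) implies the diagonal criterion (the demand rows are among the rows). -/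
theorem diagonalCriterion_of_H2 (D : Design) (φ : D.Sections) (h : D.H2 φ) : D.DiagonalCriterion φ := fun κ =>
  ⟨fun i => (h κ).1 i |>.elim fun η hη => ⟨η, fun t ht => by simpa using hη i t ht⟩,
   fun j => (h κ).2 j |>.elim fun η hη => ⟨η, fun t ht => by simpa using hη j (D.upperRowPure_self j) t ht⟩⟩

end Design

/-! ## §4 THEOREM L^ζ (stated, not proved) -/
/-- **THEOREM L^ζ IN THE FIRST-ORDER MODEL OF THE PAD-4 ANCHOR — STATED, NOT PROVED** (kernel status OPEN: `@[conjecture]`;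
cell status: PAD4-THEOREM-L v1.2 66fb170a6cb906b7 §5 + §0 COROLLARY, pencil, two independent referee reads PASS
a0ec94ca101589e9 ∕ 7768f9be2797e6b7; census state y). The director's shape `∀ design ∈ class y, ¬ ((H1) ∧ (H2))`, sections
universally quantified, minimal presentation assumed: «In the first-order model of the PAD-4 anchor, no two-level ⊕-block
line-bundle design with constituents t·h + Σ_f c_f ℓ_{ζ_f} (one null letter per factor per constituent, c_f ∈ ℤ_{≥0},
ζ_f ∈ μ₄; any support, phases, multiplicities, layers, sections) satisfies both (H1) (non-zero W-part of ch) and (H2)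
(solvability of the full first-order obstruction systems (E1) on both levels for some choice of sections; the diagonal
criterion alone is NOT the hypothesis — D₅₅ and D₄₅ pass it); nothing is asserted about other letters, ≥ 3 levels,
higher-rank ∕ semi-homogeneous ∕ sheaf ∕ complex objects, other pads, the model-to-sheaf bridge, or HC ∕ HC_AV.»
Nothing here asserts HC ∕ HC_AV; the model-to-sheaf bridge is NOT included. -/
@[conjecture] def TheoremLZeta : Prop :=
  ∀ (D : Design) (φ : D.Sections), D.InClassY → D.Minimal φ → ¬ (D.H1 ∧ D.H2 φ)

/-- **THEOREM L^ζ, main form — STATED, NOT PROVED** (kernel status OPEN: `@[conjecture]`; PAD4-THEOREM-L v1.2 §5 CLAIM,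
pencil ×2): in the first-order model, a two-level design of the standard-null-letter class with minimal presentation and
SOME constituent charged on at least two factors violates (H2) = (E1), for every choice of sections. -/
@[conjecture] def TheoremLZetaMain : Prop :=
  ∀ (D : Design) (φ : D.Sections), D.InClassY → D.Minimal φ →
    (∃ X ∈ D.lower ++ D.upper, 2 ≤ X.nCharged) → ¬ D.H2 φ

/-! ## §5 The corollary step, proved: (H1) forces a fully charged constituent -/
/-- `Π_f β_f ≠ 0` ⇒ every charge is non-zero. -/
theorem Constituent.charge_ne_zero_of_muTerm (X : Constituent) (h : X.muTerm ≠ 0) (g : Fin 4) :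
    X.charge g ≠ 0 := fun hg =>
  h (Finset.prod_eq_zero (Finset.mem_univ g) (by simp [Constituent.beta, hg]))
/-- `Π_f β_f ≠ 0` ⇒ charged on all four factors. -/
theorem Constituent.nCharged_eq_four_of_muTerm (X : Constituent) (h : X.muTerm ≠ 0) : X.nCharged = 4 := by
  unfold Constituent.nCharged
  rw [Finset.filter_true_of_mem (fun g _ => X.charge_ne_zero_of_muTerm h g)]
  simp
/-- a list of constituents with all `Π_f β_f = 0` contributes `0` to `μ`. -/
theorem sum_map_eq_zero_of_forall {l : List Constituent} (h : ∀ X ∈ l, X.muTerm = 0) :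
    (l.map Constituent.muTerm).sum = 0 := by
  apply List.sum_eq_zero
  intro x hx
  obtain ⟨X, hX, rfl⟩ := List.mem_map.1 hx
  exact h X hX

/-- (H1) `μ ≠ 0` ⇒ some constituent has `Π_f β_f ≠ 0` ⇒ it is charged on all four factors. -/
theorem exists_fullyCharged_of_H1 (D : Design) (h : D.H1) : ∃ X ∈ D.lower ++ D.upper, X.nCharged = 4 := by
  by_contra hne
  apply h
  have hz : ∀ X ∈ D.lower ++ D.upper, X.muTerm = 0 := by
    intro X hX
    by_contra hμ
    exact hne ⟨X, hX, X.nCharged_eq_four_of_muTerm hμ⟩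
  unfold Design.mu
  rw [sum_map_eq_zero_of_forall (fun X hX => hz X (List.mem_append_left _ hX)),
    sum_map_eq_zero_of_forall (fun X hX => hz X (List.mem_append_right _ hX)), sub_zero]

/-- **main form ⇒ corollary form** (the only use of (H1) in THEOREM L^ζ: PAD4-THEOREM-L §0 COROLLARY), unbundled so that
no audit reads it as a proof of `TheoremLZeta`: `TheoremLZetaMain → TheoremLZeta` is `fun h D φ hY hm => this h D φ hY hm`. -/
theorem not_H1_and_H2_of_main (h : TheoremLZetaMain) (D : Design) (φ : D.Sections) (hY : D.InClassY)
    (hmin : D.Minimal φ) : ¬ (D.H1 ∧ D.H2 φ) := by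
  rintro ⟨h1, h2⟩
  exact (exists_fullyCharged_of_H1 D h1).elim fun X ⟨hX, h4⟩ => h D φ hY hmin ⟨X, hX, by omega⟩ h2

end Summit.Ventures.HSemireg.Pad4FirstOrder

end
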